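import Literature.Probability.RandomPlanarGeometry.HexParafermion
import Literature.Probability.RandomPlanarGeometry.HexSAW
import HarnessLib

/-!
# Sketch — crux-ideate stmt-CriticalPhenomena-0808 (HexConjecture), ideator 1, round 1

First-lemma signatures for the two crux idea cards

* `marginal-reflex-wedge-cauchy-kernel` : `IsReflexWedgeTruncation`, `arcEdges`, `ReflexCornerEscape`,
  `ReflexCornerFluxLine`;
* `z2-twist-spinor-parafermion` : `twistCount`, `twistedObservable`, `TwistedVertexRelation`,
  `passageParityRatio`.

Everything is stated over `HexParafermion.lean` / `HexSAW.lean`; nothing is proved here.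
-/

namespace Summit.CriticalPhenomena.SAWScalingLimit.Cruxes.HexConjecture.Ideator1

open scoped BigOperators
open Literature.Probability.LatticeModels Literature.Probability.RandomPlanarGeometry.SAW

noncomputable section

/-- The corner boundary mid-edge of the 300° lattice wedge with apex at the hexagon centre `0`:
the vertical edge between the down-face of cell `(0,-1)` (centre `½ - i/(2√3)`, inside) and the
up-face of cell `(0,0)` (centre `½ + i/(2√3)`, in the removed 60° sector). -/
def cornerIn : HexVertex := ((![0, -1] : Site 2), (1 : Fin 2))
def cornerOut : HexVertex := ((![0, 0] : Site 2), (0 : Fin 2))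
def cornerEdge : Sym2 HexVertex := s(cornerIn, cornerOut)

/-- `Λ` is the truncated reflex wedge `W_N`: honeycomb vertices at distance `< N` from the apex and
outside the CLOSED sector `0 ≤ arg ≤ π/3`. -/
def IsReflexWedgeTruncation (Λ : Finset HexVertex) (N : ℝ) : Prop :=
  ∀ v : HexVertex, v ∈ Λ ↔
    ‖hexCenter v‖ < N ∧ ¬ (0 ≤ Complex.arg (hexCenter v) ∧ Complex.arg (hexCenter v) ≤ Real.pi / 3)

/-- The far ("arc") boundary mid-edges of `W_N`: boundary edges whose outer endpoint lies outside
the disc (a superset of the true arc; the two ray classes are excluded). -/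
def arcEdges (Λ : Finset HexVertex) (N : ℝ) : Set (Sym2 HexVertex) :=
  {z | ∃ u v : HexVertex, z = s(u, v) ∧ hexGraph.Adj u v ∧ v ∈ Λ ∧ u ∉ Λ ∧ N ≤ ‖hexCenter u‖}

/-- FIRST LEMMA (card `marginal-reflex-wedge-cauchy-kernel`): the scale-free escape bound at the
marginal reflex corner. For every truncation radius `N ≥ 1`, the critical parafermion rooted at the
corner edge of the 300° wedge has total modulus at least `cos(π/8)` on the far boundary:
`Σ_{z ∈ arc} |F(z)| ≥ cos(π/8)` (hence the same for the positive masses `Z(z) = F_{σ=0}(z) ≥ |F(z)|`).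
Source of the bound: the two rays carry opposite phases in the DCS flux identity (lifted-normal
difference `-8π/3`, times `1-σ = 3/8` gives `-π`), so the identity reads
`e^{-iπ/8}(Z₀ - Z₆₀) + Φ_arc = -i` in units of half an edge, a line missing the origin by `cos(π/8)`. -/
def ReflexCornerEscape : Prop :=
  ∀ (Λ : Finset HexVertex) (N : ℝ), 1 ≤ N → IsReflexWedgeTruncation Λ N →
    Real.cos (Real.pi / 8) ≤
      ∑ᶠ z ∈ arcEdges Λ N,
        ‖hexParafermionicObservable Λ cornerEdge hexCriticalFugacity (5 / 8) z‖

/-- The exact form behind `ReflexCornerEscape`: the far-boundary flux of the critical observable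
lies on the line `(1/(2√3))·(-i - e^{-iπ/8}·ℝ)` (here `1/(2√3)` is half the edge length of the
embedded honeycomb, hexagon centres at unit spacing). -/
def ReflexCornerFluxLine : Prop :=
  ∀ (Λ : Finset HexVertex) (N : ℝ), 1 ≤ N → IsReflexWedgeTruncation Λ N →
    ∃ D : ℝ,
      (∑ᶠ p ∈ {p : HexVertex × HexVertex |
          hexGraph.Adj p.1 p.2 ∧ p.2 ∈ Λ ∧ p.1 ∉ Λ ∧ N ≤ ‖hexCenter p.1‖},
        (hexMidpoint s(p.1, p.2) - hexCenter p.2) *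
          hexParafermionicObservable Λ cornerEdge hexCriticalFugacity (5 / 8) s(p.1, p.2))
        = (1 / (2 * Real.sqrt 3) : ℂ) *
            (-Complex.I - Complex.exp (-Complex.I * (Real.pi / 8)) * (D : ℂ))

/-! ### Card `z2-twist-spinor-parafermion` -/

/-- Number of edges of the walk `γ : a → z` (the list `a, {v₁,v₂}, …, {vₙ₋₁,vₙ}, z`) lying in the
twist set `C`. -/
def twistCount {Λ : Finset HexVertex} {a z : Sym2 HexVertex} (C : Finset (Sym2 HexVertex))
    (γ : HexMidEdgeSAW Λ a z) : ℕ :=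
  ((a :: List.zipWith (fun u w => s(u, w)) γ.verts γ.verts.tail ++ [z]).countP fun e => decide (e ∈ C))

/-- The `C`-twisted parafermionic observable
`F^C(z) = Σ_{γ : a → z} (-1)^{#(E(γ) ∩ C)} e^{-iσW(γ)} x^{ℓ(γ)}`. For `C` the set of edges crossed by a
dual path from a face `f` to the outer face this is the ℤ₂-spinor parafermion branched at `f`
(a section of the flat line bundle with monodromy `-1` about `f`); for `C = ∅` it is the DCS
observable. -/
def twistedObservable (Λ : Finset HexVertex) (a : Sym2 HexVertex) (C : Finset (Sym2 HexVertex))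
    (x σ : ℝ) (z : Sym2 HexVertex) : ℂ :=
  ∑ γ : HexMidEdgeSAW Λ a z, (-1 : ℂ) ^ twistCount C γ * γ.weight x σ

/-- FIRST LEMMA (card `z2-twist-spinor-parafermion`): for EVERY finite edge set `C`, the twisted
observable at `x = x_c`, `σ = 5/8` satisfies the Duminil-Copin–Smirnov vertex relation at every
vertex of the domain none of whose three edges lies in `C` (DCS pairs traverse the same edge SET,
so carry the same sign; triplets are untouched away from `C`). -/
def TwistedVertexRelation : Prop :=
  ∀ (Λ : Finset HexVertex), hexDomainSimplyConnected Λ →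
    ∀ a ∈ hexDomainBoundary Λ, ∀ (C : Finset (Sym2 HexVertex)),
      ∀ v ∈ Λ, (∀ w : HexVertex, hexGraph.Adj v w → s(v, w) ∉ C) →
        ∀ p q r : HexVertex, hexGraph.Adj v p → hexGraph.Adj v q → hexGraph.Adj v r →
          p ≠ q → q ≠ r → p ≠ r →
          (hexMidpoint s(v, p) - hexCenter v) *
              twistedObservable Λ a C hexCriticalFugacity (5 / 8) s(v, p) +
            (hexMidpoint s(v, q) - hexCenter v) *
              twistedObservable Λ a C hexCriticalFugacity (5 / 8) s(v, q) +
            (hexMidpoint s(v, r) - hexCenter v) *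
              twistedObservable Λ a C hexCriticalFugacity (5 / 8) s(v, r) = 0

/-- The normalisation-free boundary ratio: for a ℤ₂-cut `C` from the face `f` and a second boundary
mid-edge `b`, `F^C(b)/F(b) = (Z_even - Z_odd)/(Z_even + Z_odd)` is the passage-parity expectation
`E[(-1)^{1{f right of γ}}]` of the chordal critical SAW `a → b` (lattice factors at `b` cancel); its
conjectural limit in `(ℍ; 0, ∞)` is Schramm–Malus `-cos(arg f)`. Recorded as a definition. -/
def passageParityRatio (Λ : Finset HexVertex) (a b : Sym2 HexVertex)
    (C : Finset (Sym2 HexVertex)) : ℂ :=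
  twistedObservable Λ a C hexCriticalFugacity (5 / 8) b /
    hexParafermionicObservable Λ a hexCriticalFugacity (5 / 8) b

end

end Summit.CriticalPhenomena.SAWScalingLimit.Cruxes.HexConjecture.Ideator1
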